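import Summits.CriticalPhenomena.PercolationContinuityZ3.Theorems.PercNearOneGluingNoHeavyLowerTailKnQuestion8CoefficientwiseCoreClassKernelMixBoundaryFibres
import HarnessLib

/-!
# Boundary inequality on bundles, II: prefix-frozen fibres on a thread (abstract bookkeeping)

Support file (`--supports stmt-CriticalPhenomena-4575`, closed), prover `prim-cplus-coupling` (gen 46).  No definitions, no notations, no named facts,
no sorries; standard axioms.  Memo `prim-cplus-coupling/A5-COUPLING-gen45.md` §3.9 (THEOREM BI), the bookkeeping of step (a)/(c).

A THREAD is an injective enumeration `e 1, …, e ℓ` of a finite edge set `P`; `pre a = {e 1, …, e a}` is its prefix of length `a`.  The PREFIX-FROZEN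
FIBRE of length `a ≥ 1` consists of the colourings `ξ` with `ξ ∩ pre (a+1) = pre a` (word `R^a B …` on the thread: the first `a` edges red, edge
`a+1` blue); length `a = 0` means 'nothing frozen'.  This file records:
* `Coefficientwise.prefix_fibre_disjoint` — fibres of different lengths `a, a' ≥ 1` are disjoint (the length is readable);
* `Coefficientwise.prefix_fibre_cover` — a colouring whose thread word starts red and is not full lies in the fibre of some length `1 ≤ a < ℓ`;
* `Coefficientwise.prefix_partner_mem` — edge-by-edge description of a fibre point `ξ` and of its PARTNER `ρ = π ∪ ((E' ∖ Φ) ∖ ξ)` on the thread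
  (prefix red in both, edge `a+1` blue in both, the remaining edges complementary), and 'frozen ⟹ thread not full';
* `Coefficientwise.prefix_fibre_inter_iff` — a pair of frozen blocks on two disjoint threads is one cylinder `ξ ∩ Φ = π`.
Consumed by `…KernelMixBoundaryPrefixFlows` (the two fibre systems of THEOREM BI).  [cite: KozmaNitzan2024, Questions 8–9 (§5.5 p. 36) (context)]
-/

namespace Summit.CriticalPhenomena.PercolationContinuityZ3.Theorems

open Finset

namespace Coefficientwise

variable {ι : Type*}

open Classical in
/-- Prefix-frozen fibres of different lengths `a ≠ a'` (both `≥ 1`) on one thread are disjoint: no colouring `ξ` has both `ξ ∩ pre(a+1) = pre a` and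
`ξ ∩ pre(a'+1) = pre a'`. [folklore] -/
theorem prefix_fibre_disjoint (e : ℕ → ι) (ℓ : ℕ)
    (hinj : ∀ i j, 1 ≤ i → i ≤ ℓ → 1 ≤ j → j ≤ ℓ → e i = e j → i = j)
    (pre : ℕ → Finset ι) (hpre : ∀ a x, x ∈ pre a ↔ ∃ j, 1 ≤ j ∧ j ≤ a ∧ e j = x)
    (a a' : ℕ) (ha : 1 ≤ a) (ha' : 1 ≤ a') (haℓ : a < ℓ) (ha'ℓ : a' < ℓ) (hne : a ≠ a')
    (ξ : Finset ι) (h1 : ξ ∩ pre (a + 1) = pre a) (h2 : ξ ∩ pre (a' + 1) = pre a') : False := by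
  have key : ∀ b b', 1 ≤ b → b < b' → b' < ℓ → ξ ∩ pre (b + 1) = pre b → ξ ∩ pre (b' + 1) = pre b' → False := by
    intro b b' _ hbb' hb'ℓ e1 e2
    have hin : e (b + 1) ∈ ξ := by
      have hm : e (b + 1) ∈ pre b' := (hpre b' _).mpr ⟨b + 1, by omega, by omega, rfl⟩
      rw [← e2] at hm; exact (Finset.mem_inter.mp hm).1
    have hin2 : e (b + 1) ∈ ξ ∩ pre (b + 1) := Finset.mem_inter.mpr ⟨hin, (hpre _ _).mpr ⟨b + 1, by omega, le_refl _, rfl⟩⟩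
    rw [e1] at hin2
    obtain ⟨j, hj1, hjb, hj⟩ := (hpre b _).mp hin2
    have := hinj j (b + 1) hj1 (by omega) (by omega) (by omega) hj
    omega
  rcases Nat.lt_or_gt_of_ne hne with h | h
  · exact key a a' ha h ha'ℓ h1 h2
  · exact key a' a ha' h haℓ h2 h1

open Classical in
/-- A colouring `ξ` whose thread word starts red (`e 1 ∈ ξ`) and is not full (`¬ P ⊆ ξ`, `P = {e 1, …, e ℓ}`) lies in the prefix-frozen fibre of a unique length
`1 ≤ a < ℓ`: `ξ ∩ pre(a+1) = pre a` (`a + 1` = the first blue position). [folklore] -/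
theorem prefix_fibre_cover (e : ℕ → ι) (ℓ : ℕ) (P : Finset ι) (hPe : ∀ x ∈ P, ∃ j, 1 ≤ j ∧ j ≤ ℓ ∧ e j = x)
    (pre : ℕ → Finset ι) (hpre : ∀ a x, x ∈ pre a ↔ ∃ j, 1 ≤ j ∧ j ≤ a ∧ e j = x)
    (ξ : Finset ι) (h1 : e 1 ∈ ξ) (hnP : ¬ P ⊆ ξ) :
    ∃ a, 1 ≤ a ∧ a < ℓ ∧ ξ ∩ pre (a + 1) = pre a := by
  have hex : ∃ j, 1 ≤ j ∧ j ≤ ℓ ∧ e j ∉ ξ := by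
    obtain ⟨x, hxP, hxξ⟩ := Finset.not_subset.mp hnP
    obtain ⟨j, hj1, hjℓ, rfl⟩ := hPe x hxP
    exact ⟨j, hj1, hjℓ, hxξ⟩
  obtain ⟨hj₀1, hj₀ℓ, hj₀ξ⟩ := Nat.find_spec hex
  have hmin : ∀ j, j < Nat.find hex → 1 ≤ j → j ≤ ℓ → e j ∈ ξ := by
    intro j hj hj1 hjℓ
    by_contra hn
    exact Nat.find_min hex hj ⟨hj1, hjℓ, hn⟩
  have hj₀2 : 2 ≤ Nat.find hex := by
    by_contra h
    have h1' : Nat.find hex = 1 := by omega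
    rw [h1'] at hj₀ξ; exact hj₀ξ h1
  refine ⟨Nat.find hex - 1, by omega, by omega, ?_⟩
  have hj : Nat.find hex - 1 + 1 = Nat.find hex := by omega
  rw [hj]
  ext x
  rw [Finset.mem_inter, hpre, hpre]
  constructor
  · rintro ⟨hx, j, hj1, hjle, rfl⟩
    refine ⟨j, hj1, ?_, rfl⟩
    by_contra hgt
    have hjj : j = Nat.find hex := by omega
    rw [hjj] at hx; exact hj₀ξ hx
  · rintro ⟨j, hj1, hjle, rfl⟩
    exact ⟨hmin j (by omega) hj1 (by omega), j, hj1, by omega, rfl⟩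

open Classical in
/-- **Edge-by-edge description of a prefix-frozen fibre point and its partner.**  Thread `e 1..e ℓ` with edge set `P ⊆ E'`, prefixes `pre`; frozen length
`a < ℓ` with frozen block `Φf` (`= ∅` if `a = 0`, `= pre(a+1)` if `a ≥ 1`); a second frozen block `ΦO ⊇ πO` disjoint from `P` (the other thread);
`Φ = Φf ∪ ΦO`, `π = pre a ∪ πO`.  For `ξ` with `ξ ∩ Φf = pre a` and its partner `ρ = π ∪ ((E' ∖ Φ) ∖ ξ)`: the first `a` edges are red in `ξ` and in
`ρ`; if `a ≥ 1` the edge `a+1` is blue in both; every other edge of the thread is red in `ρ` iff it is blue in `ξ`; and if `a ≥ 1` the thread is not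
full in `ξ`.  Memo gen 45 §3.9 (a). [folklore] -/
theorem prefix_partner_mem (e : ℕ → ι) (ℓ : ℕ) (P E' Φ π ΦO πO : Finset ι)
    (hinj : ∀ i j, 1 ≤ i → i ≤ ℓ → 1 ≤ j → j ≤ ℓ → e i = e j → i = j)
    (heP : ∀ j, 1 ≤ j → j ≤ ℓ → e j ∈ P) (hPE : P ⊆ E') (hΦO : Disjoint ΦO P) (hπO : πO ⊆ ΦO)
    (pre : ℕ → Finset ι) (hpre : ∀ a x, x ∈ pre a ↔ ∃ j, 1 ≤ j ∧ j ≤ a ∧ e j = x)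
    (a : ℕ) (haℓ : a < ℓ) (Φf : Finset ι) (hΦf : (a = 0 ∧ Φf = ∅) ∨ (1 ≤ a ∧ Φf = pre (a + 1)))
    (hΦ : Φ = Φf ∪ ΦO) (hπ : π = pre a ∪ πO)
    (ξ : Finset ι) (hfib : ξ ∩ Φf = pre a) :
    (∀ j, 1 ≤ j → j ≤ a → e j ∈ ξ ∧ e j ∈ π ∪ ((E' \ Φ) \ ξ)) ∧
    (1 ≤ a → e (a + 1) ∉ ξ ∧ e (a + 1) ∉ π ∪ ((E' \ Φ) \ ξ)) ∧
    (∀ j, 1 ≤ j → j ≤ ℓ → (a = 0 ∨ a + 2 ≤ j) → (e j ∈ π ∪ ((E' \ Φ) \ ξ) ↔ e j ∉ ξ)) ∧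
    (1 ≤ a → ¬ P ⊆ ξ) := by
  -- an edge of the thread beyond position `n` is not in `pre n`
  have notpre : ∀ n j, n < j → j ≤ ℓ → n ≤ ℓ → e j ∉ pre n := by
    intro n j hnj hjℓ hnℓ hm
    obtain ⟨j', hj'1, hj'n, hj'⟩ := (hpre n _).mp hm
    have := hinj j' j hj'1 (by omega) (by omega) hjℓ hj'
    omega
  have notO : ∀ j, 1 ≤ j → j ≤ ℓ → e j ∉ ΦO := fun j hj1 hjℓ hm => Finset.disjoint_left.mp hΦO hm (heP j hj1 hjℓ)
  have pre_sub_ξ : pre a ⊆ ξ := by rw [← hfib]; exact Finset.inter_subset_left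
  have blue : 1 ≤ a → e (a + 1) ∉ ξ := by
    intro ha hm
    rcases hΦf with ⟨h0, _⟩ | ⟨_, hF⟩
    · omega
    · have : e (a + 1) ∈ ξ ∩ Φf := Finset.mem_inter.mpr ⟨hm, by rw [hF]; exact (hpre _ _).mpr ⟨a + 1, by omega, le_refl _, rfl⟩⟩
      rw [hfib] at this
      exact notpre a (a + 1) (by omega) (by omega) (by omega) this
  refine ⟨?_, ?_, ?_, ?_⟩
  · intro j hj1 hja
    have hm : e j ∈ pre a := (hpre a _).mpr ⟨j, hj1, hja, rfl⟩
    exact ⟨pre_sub_ξ hm, Finset.mem_union_left _ (by rw [hπ]; exact Finset.mem_union_left _ hm)⟩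
  · intro ha
    refine ⟨blue ha, ?_⟩
    intro hm
    rcases Finset.mem_union.mp hm with hm | hm
    · rw [hπ] at hm
      rcases Finset.mem_union.mp hm with hm | hm
      · exact notpre a (a + 1) (by omega) (by omega) (by omega) hm
      · exact notO (a + 1) (by omega) (by omega) (hπO hm)
    · have hΦm : e (a + 1) ∈ Φ := by
        rcases hΦf with ⟨h0, _⟩ | ⟨_, hF⟩
        · omega
        · rw [hΦ, hF]; exact Finset.mem_union_left _ ((hpre _ _).mpr ⟨a + 1, by omega, le_refl _, rfl⟩)
      exact (Finset.mem_sdiff.mp (Finset.mem_sdiff.mp hm).1).2 hΦm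
  · intro j hj1 hjℓ hfree
    have hΦm : e j ∉ Φ := by
      rw [hΦ, Finset.mem_union, not_or]
      refine ⟨?_, notO j hj1 hjℓ⟩
      rcases hΦf with ⟨_, hF⟩ | ⟨_, hF⟩
      · rw [hF]; exact Finset.notMem_empty _
      · rw [hF]; exact notpre (a + 1) j (by omega) hjℓ (by omega)
    have hπm : e j ∉ π := by
      rw [hπ, Finset.mem_union, not_or]
      exact ⟨notpre a j (by omega) hjℓ (by omega), fun hm => notO j hj1 hjℓ (hπO hm)⟩
    rw [Finset.mem_union, Finset.mem_sdiff, Finset.mem_sdiff]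
    constructor
    · rintro (h | ⟨⟨_, _⟩, h⟩)
      · exact absurd h hπm
      · exact h
    · intro h; exact Or.inr ⟨⟨hPE (heP j hj1 hjℓ), hΦm⟩, h⟩
  · intro ha hP
    exact blue ha (hP (heP (a + 1) (by omega) (by omega)))

/-- Two frozen blocks on disjoint threads form one cylinder: for `πP ⊆ ΦP ⊆ P`, `πQ ⊆ ΦQ ⊆ Q`, `P ∩ Q = ∅`,
`(ξ ∩ ΦP = πP ∧ ξ ∩ ΦQ = πQ) ↔ ξ ∩ (ΦP ∪ ΦQ) = πP ∪ πQ`. [folklore] -/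
theorem prefix_fibre_inter_iff [DecidableEq ι] (P Q ΦP πP ΦQ πQ ξ : Finset ι) (hPQ : Disjoint P Q)
    (h1 : πP ⊆ ΦP) (h2 : ΦP ⊆ P) (h3 : πQ ⊆ ΦQ) (h4 : ΦQ ⊆ Q) :
    (ξ ∩ ΦP = πP ∧ ξ ∩ ΦQ = πQ) ↔ ξ ∩ (ΦP ∪ ΦQ) = πP ∪ πQ := by
  constructor
  · rintro ⟨e1, e2⟩
    rw [Finset.inter_union_distrib_left, e1, e2]
  · intro h
    have hx : ∀ x, (x ∈ ξ ∧ (x ∈ ΦP ∨ x ∈ ΦQ)) ↔ (x ∈ πP ∨ x ∈ πQ) := by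
      intro x
      have := Finset.ext_iff.mp h x
      rw [Finset.mem_inter, Finset.mem_union, Finset.mem_union] at this
      exact this
    constructor
    · ext x
      rw [Finset.mem_inter]
      constructor
      · rintro ⟨hξ, hΦ⟩
        rcases (hx x).mp ⟨hξ, Or.inl hΦ⟩ with h' | h'
        · exact h'
        · exact absurd (h2 hΦ) (Finset.disjoint_right.mp hPQ (h4 (h3 h')))
      · intro hπ
        exact ⟨((hx x).mpr (Or.inl hπ)).1, h1 hπ⟩
    · ext x
      rw [Finset.mem_inter]
      constructor
      · rintro ⟨hξ, hΦ⟩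
        rcases (hx x).mp ⟨hξ, Or.inr hΦ⟩ with h' | h'
        · exact absurd (h2 (h1 h')) (Finset.disjoint_right.mp hPQ (h4 hΦ))
        · exact h'
      · intro hπ
        exact ⟨((hx x).mpr (Or.inr hπ)).1, h3 hπ⟩

end Coefficientwise

end Summit.CriticalPhenomena.PercolationContinuityZ3.Theorems
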